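import Summits.RiemannHypothesis.RiemannHypothesis.Theorems.NymanBeurlingNbThesis
import Summits.RiemannHypothesis.RiemannHypothesis.Theorems.NymanBeurlingNbThesisZeroFloor
import Summits.RiemannHypothesis.RiemannHypothesis.Theorems.NymanBeurlingNbThesisIntegrable
import Summits.RiemannHypothesis.RiemannHypothesis.Theorems.Splittings.NbSharpFloor
import Summits.RiemannHypothesis.RiemannHypothesis.Theorems.Splittings.CostumeDetectorsNbNeg
import Summits.RiemannHypothesis.RiemannHypothesis.Theorems.Splittings.NbBddNatural
import HarnessLib

/-!
# Tail polarisation VIII (NB-NEG: lower / anti-decay tails are `¬RH`-implied, hence idle; the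
# visibility level of an off-line zero under a rate conjunct) — cell `rh-split`, raw forms, ZERO defs;
# typed by rh-split-nb-neg g6

Companion of `CostumeDetectorsNbNeg.lean` (upper tails: level / rate / doubling tails give RH alone)
and `NbSharpFloor.lean` (the sharp zero floor `4π(Re ρ-1/2)‖ρ-1‖²/(‖ρ‖²‖ρ+1‖²) ≤ I(N,a)`).
Card `run/shared/lean/pub/rh-split/cards/SPLIT-nb-neg.md` §12 (gen 6).  Notation of the comments:
`I(N,a) = ∫⁻ ‖1 - ζ(1/2+it)·Σ_{k<N} a_k (k+1)^{-(1/2+it)}‖² dt/(1/4+t²) = 2π d_N(a)²`,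
`D(N) = inf_a ∫ …` (Bochner form), `I(V_N)` = the same integral at the natural approximant
`a_k = μ(k+1)(1 - log(k+1)/log N)`.

POLARISATION of tail conjuncts `T(H)` in a splitting scheme `FIN(H) ∧ T(H) ⟹ RH`:

* §TP.0 (logic, definition-free).  If `T ⟹ RH` the finite conjunct is decoration
  (`split_of_tail_imp_rh`); if `¬RH ⟹ T` the tail is IDLE and the scheme collapses to `FIN ⟹ RH`
  (`imp_rh_of_split_of_not_rh_imp`; eventual form `eventually_imp_rh_of_scheme`).
* §TP.1 (NB lower tails are `¬RH`-implied, kernel).  A positive tail floor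
  `∃ c>0, ∀ N ≥ H, ∀ a, c ≤ I(N,a)` is EQUIVALENT to `¬RH` at every `H` (`nb_tailFloor_iff_not_rh`);
  `¬RH` gives every lower rate tail `c/log N ≤ I(N,a)` from some level on, for EVERY constant `c`
  (`nb_lowerRateTail_of_not_rh`), every anti-doubling tail `θ·D(N) < D(N²)`, `θ < 1`
  (`nb_antiDoubling_of_not_rh`, via the abstract `antiDoubling_of_antitone_of_floor`), and every
  lower tail `B < I(V_N)` of the natural approximants (`natural_lowerTail_of_not_rh`).  Hence the
  corresponding splitting schemes collapse to `FIN ⟹ RH` (`nb_fin_alone_of_*`).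
* §TP.2 (VISIBILITY LEVEL — answer to detector VII for the NB rows).  An off-line zero `ρ` refutes the
  rate conjunct `∃ a, I(N,a) ≤ C/log N` at EVERY level `N > exp(C/F(ρ))`,
  `F(ρ) = 4π(Re ρ-1/2)‖ρ-1‖²/(‖ρ‖²‖ρ+1‖²) ≈ 4πδ/γ₀²` (`nb_rateLevel_refuted_by_zero`,
  `nb_rateLevel_refuted_by_zero_exp`), so the rate TAIL is refuted at every `H`
  (`not_nb_rateTail_of_zero`, the pointwise-in-`ρ` effective form of `rh_of_nb_rateTail`):
  `log N_vis(ρ, C) = C‖ρ‖²‖ρ+1‖²/(4π(Re ρ-1/2)‖ρ-1‖²) ≈ (C/4π)·γ₀²/δ`.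

Every statement spells `_root_.RiemannHypothesis`.  No definitions.

HONEST LABEL: «SPLITTING SEARCH over kernel-typed RH-EQUIVALENCES; a splitting A ∧ B ⟹ RH is CONDITIONAL
bookkeeping unless A and B are both proved; nothing here bears on the truth of RH.»
FILING NOTE (rh-split-typer-1 g4): the seat's file (sha16 dac4471285db43a5, 439 l; referee rh-split-ref g3 CONTENT PASS «AS IS»
2026-08-27T04:25:56Z) exceeds the 400-line rule for Theorems files, so it is filed in TWO parts with byte-identical declarations:
this file = §TP.0–§TP.2; `NbTailPolarisationSchemes.lean` = §TP.3–§TP.4 (scheme collapses; polarisation by model class).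
-/

noncomputable section

-- D-0017: `Summit.<S>.<S>.…` is the designed namespace of a single-problem summit.
set_option linter.dupNamespace false

open Complex MeasureTheory Set Filter Topology
open scoped Real ENNReal

namespace Summit.RiemannHypothesis.RiemannHypothesis.Theorems.Splittings.NbTailPolarisation

open Summit.RiemannHypothesis.RiemannHypothesis.Theses.NymanBeurling
open Summit.RiemannHypothesis.RiemannHypothesis.Theorems
open Summit.RiemannHypothesis.RiemannHypothesis.Theorems.Splittings.NbSharpFloor
open Summit.RiemannHypothesis.RiemannHypothesis.Theorems.Splittings.CostumeDetectorsNbNeg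
open Summit.RiemannHypothesis.RiemannHypothesis.Theorems.Splittings.NbBddNatural

/-! ## §TP.0 — polarisation logic (definition-free) -/

/-- POLARISATION, costume side: if the tail conjunct alone gives RH, then `A ∧ T ⟹ RH` holds for
EVERY finite conjunct `A` — `A` is decoration. [folklore] -/
theorem split_of_tail_imp_rh {A T : Prop} (hT : T → _root_.RiemannHypothesis) :
    A → T → _root_.RiemannHypothesis := fun _ h ↦ hT h

/-- POLARISATION, idle side: if the tail conjunct `T` is implied by `¬RH`, every splitting
`A ∧ T ⟹ RH` collapses to `A ⟹ RH` — the tail carries nothing and the finite conjunct must give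
RH on its own. [folklore] -/
theorem imp_rh_of_split_of_not_rh_imp {A T : Prop} (hT : ¬ _root_.RiemannHypothesis → T)
    (hsplit : A → T → _root_.RiemannHypothesis) : A → _root_.RiemannHypothesis :=
  fun hA ↦ Classical.byContradiction fun hRH ↦ hRH (hsplit hA (hT hRH))

/-- POLARISATION, idle side, eventual form: if `¬RH ⟹ T H` for all `H ≥ H₀` (an INEFFECTIVE `H₀`,
depending on the hypothetical off-line zero) and the scheme `A H ∧ T H ⟹ RH` is valid from `H₁` on,
then from some level `H₂ ≥ H₁` on the finite conjunct gives RH BY ITSELF. [folklore] -/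
theorem eventually_imp_rh_of_scheme {A T : ℕ → Prop}
    (hT : ¬ _root_.RiemannHypothesis → ∃ H₀ : ℕ, ∀ H : ℕ, H₀ ≤ H → T H) {H₁ : ℕ}
    (hsplit : ∀ H : ℕ, H₁ ≤ H → A H → T H → _root_.RiemannHypothesis) :
    ∃ H₂ : ℕ, H₁ ≤ H₂ ∧ ∀ H : ℕ, H₂ ≤ H → A H → _root_.RiemannHypothesis := by
  by_cases hRH : _root_.RiemannHypothesis
  · exact ⟨H₁, le_rfl, fun _ _ _ ↦ hRH⟩
  · obtain ⟨H₀, hH₀⟩ := hT hRH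
    exact ⟨max H₀ H₁, le_max_right _ _, fun H hH hAH ↦
      hsplit H ((le_max_right _ _).trans hH) hAH (hH₀ H ((le_max_left _ _).trans hH))⟩

/-! ## §TP.1 — NB lower tails are `¬RH`-implied (idle) -/

/-- **Tail floor ≡ ¬RH at every level.** A positive constant below every Nyman–Beurling value of
level `≥ H` exists iff RH fails: `¬RH` gives the uniform floor
(`nb_uniform_floor_of_not_riemannHypothesis`, Beurling's easy half), and under RH the level tail
`nb_levelTail_iff_rh` produces values below any `c > 0` at levels `≥ H`.  So the conjunct
«tail floor» is `¬RH` in costume and `FIN(H) ∧ TailFloor(H) ⟹ RH` is `FIN(H) ⟹ RH`.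
[cite: Beurling1955, Theorem (easy half)] [cite: BaezDuarte2003, Thm. 1.1] -/
theorem nb_tailFloor_iff_not_rh (H : ℕ) :
    (∃ c : ℝ, 0 < c ∧ ∀ N : ℕ, H ≤ N → ∀ a : Fin N → ℂ, ENNReal.ofReal c ≤
      ∫⁻ t : ℝ, ENNReal.ofReal (‖1 - riemannZeta (1 / 2 + t * Complex.I) *
        ∑ n : Fin N, a n * ((n : ℂ) + 1) ^ (-(1 / 2 + t * Complex.I))‖ ^ 2 / (1 / 4 + t ^ 2))) ↔
    ¬ _root_.RiemannHypothesis := by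
  constructor
  · rintro ⟨c, hc, h⟩ hRH
    obtain ⟨N, hN, a, ha⟩ := (nb_levelTail_iff_rh H).mpr hRH c hc
    exact absurd (lt_of_le_of_lt (h N hN a) ha) (lt_irrefl _)
  · intro hRH
    obtain ⟨c, hc, h⟩ := nb_uniform_floor_of_not_riemannHypothesis hRH
    exact ⟨c, hc, fun N _ a ↦ h N a⟩

/-- **Lower rate tails under ¬RH, every constant.** If RH fails then for EVERY `c : ℝ` there is a
level `H₀` with `c/log N ≤ I(N,a)` for all `N ≥ H₀` and all `a` (uniform floor `c₀ > 0`; take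
`log H₀ ≥ c/c₀`).  `H₀` is ineffective (it depends on the off-line zero through `c₀`).  Under the
printed asymptotic `inf_a I(N,a) ~ 0.2902/log N` (RH ∧ simple) the conjunct is FALSE for `c > 0.2902`,
so «lower rate tail with `c > C₀`» ≈ `¬RH`; for `c ≤ 0.214` it is a theorem-grade floor
(`lt_const_of_eventually_nbRateBound`).  Either way it is idle in a splitting.
[cite: Beurling1955, Theorem (easy half)] [cite: Burnol2002, Thm. 1.3] [cite: BDBLS2000, conjecture] -/
theorem nb_lowerRateTail_of_not_rh (hRH : ¬ _root_.RiemannHypothesis) (c : ℝ) :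
    ∃ H₀ : ℕ, ∀ N : ℕ, H₀ ≤ N → ∀ a : Fin N → ℂ, ENNReal.ofReal (c / Real.log N) ≤
      ∫⁻ t : ℝ, ENNReal.ofReal (‖1 - riemannZeta (1 / 2 + t * Complex.I) *
        ∑ n : Fin N, a n * ((n : ℂ) + 1) ^ (-(1 / 2 + t * Complex.I))‖ ^ 2 / (1 / 4 + t ^ 2)) := by
  obtain ⟨c₀, hc₀, h⟩ := nb_uniform_floor_of_not_riemannHypothesis hRH
  refine ⟨⌈Real.exp (c / c₀)⌉₊ + 2, fun N hN a ↦ le_trans (ENNReal.ofReal_le_ofReal ?_) (h N a)⟩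
  have hN2 : 2 ≤ N := by omega
  have hNc : ⌈Real.exp (c / c₀)⌉₊ ≤ N := by omega
  have hN2' : (2 : ℝ) ≤ (N : ℝ) := by exact_mod_cast hN2
  have hlog : 0 < Real.log N := Real.log_pos (by linarith)
  have hexp : Real.exp (c / c₀) ≤ N := (Nat.le_ceil _).trans (by exact_mod_cast hNc)
  have h1 : c / c₀ ≤ Real.log N := by
    have := Real.log_le_log (Real.exp_pos _) hexp
    rwa [Real.log_exp] at this
  rw [div_le_iff₀ hlog]
  rw [div_le_iff₀ hc₀] at h1
  linarith

/-- **Real `⨅` form of the floor.** Under `¬RH` the per-level minimum `D(N) = inf_a ∫ …` is bounded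
below by ONE positive constant at EVERY level `N` (move `nb_uniform_floor_of_not_riemannHypothesis`
from `∫⁻` to the Bochner `⨅`). [cite: Beurling1955, Theorem (easy half)] -/
theorem nb_dist_floor_pos_of_not_rh (hRH : ¬ _root_.RiemannHypothesis) :
    ∃ c : ℝ, 0 < c ∧ ∀ N : ℕ, c ≤ ⨅ a : Fin N → ℂ, ∫ t : ℝ, ‖1 - riemannZeta (1 / 2 + t * I) *
        ∑ n : Fin N, a n * ((n : ℂ) + 1) ^ (-(1 / 2 + t * I))‖ ^ 2 / (1 / 4 + t ^ 2) := by
  obtain ⟨c, hc, h⟩ := nb_uniform_floor_of_not_riemannHypothesis hRH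
  refine ⟨c, hc, fun N ↦ le_ciInf fun a ↦ ?_⟩
  have h1 := h N a
  rw [nb_lintegral_eq_ofReal_integral a] at h1
  exact (ENNReal.ofReal_le_ofReal_iff (nb_integral_nonneg a)).mp h1

/-- Abstract lemma (no definitions): an ANTITONE real sequence with a positive lower bound satisfies,
for every `θ < 1`, `θ·D(N) < D(N²)` from some `N` on (`D ↓ L > 0`, pick `D(N₀) < L/θ`). [folklore] -/
theorem antiDoubling_of_antitone_of_floor (D : ℕ → ℝ) (hanti : Antitone D) {c : ℝ} (hc : 0 < c)
    (hfloor : ∀ N, c ≤ D N) {θ : ℝ} (hθ : θ < 1) :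
    ∃ H₀ : ℕ, ∀ N : ℕ, H₀ ≤ N → θ * D N < D (N ^ 2) := by
  have hbdd : BddBelow (Set.range D) := ⟨c, by rintro _ ⟨N, rfl⟩; exact hfloor N⟩
  have hLle : ∀ N, iInf D ≤ D N := fun N ↦ ciInf_le hbdd N
  have hLpos : 0 < iInf D := hc.trans_le (le_ciInf hfloor)
  rcases le_or_gt θ 0 with hθ0 | hθ0
  · refine ⟨0, fun N _ ↦ ?_⟩
    have h1 : θ * D N ≤ 0 := mul_nonpos_of_nonpos_of_nonneg hθ0 (hc.le.trans (hfloor N))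
    exact h1.trans_lt (hLpos.trans_le (hLle _))
  · have hθne : θ ≠ 0 := hθ0.ne'
    have hlt : iInf D < iInf D / θ := by
      rw [lt_div_iff₀ hθ0]
      nlinarith [mul_pos hLpos (sub_pos.mpr hθ)]
    obtain ⟨N₀, hN₀⟩ := exists_lt_of_ciInf_lt hlt
    refine ⟨N₀, fun N hN ↦ ?_⟩
    calc θ * D N ≤ θ * D N₀ := mul_le_mul_of_nonneg_left (hanti hN) hθ0.le
      _ < θ * (iInf D / θ) := mul_lt_mul_of_pos_left hN₀ hθ0
      _ = iInf D := by field_simp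
      _ ≤ D (N ^ 2) := hLle _

/-- **Anti-doubling tails under ¬RH.** If RH fails then for every `θ < 1` the anti-decay tail
«`θ·D(N) < D(N²)` for all `N ≥ H₀`» holds from some (ineffective) level on (`D` antitone,
`nb_dist_antitone`, with a positive floor).  With `rh_of_nb_doublingTail` (`D(N²) ≤ θ D(N)` beyond `H`
⟹ RH) this POLARISES the doubling family completely: the decay side is RH-or-stronger, the
anti-decay side is `¬RH`-implied; under the printed asymptotic the ratio `D(N²)/D(N) → 1/2`, so for
`1/2 < θ < 1` the anti-doubling tail ≈ `¬RH` and for `θ < 1/2` it is believed true outright.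
[cite: BaezDuarte2003, Thm. 1.1] [cite: BDBLS2000, conjecture] -/
theorem nb_antiDoubling_of_not_rh (hRH : ¬ _root_.RiemannHypothesis) {θ : ℝ} (hθ : θ < 1) :
    ∃ H₀ : ℕ, ∀ N : ℕ, H₀ ≤ N →
      θ * (⨅ a : Fin N → ℂ, ∫ t : ℝ, ‖1 - riemannZeta (1 / 2 + t * I) *
        ∑ n : Fin N, a n * ((n : ℂ) + 1) ^ (-(1 / 2 + t * I))‖ ^ 2 / (1 / 4 + t ^ 2)) <
      ⨅ a : Fin (N ^ 2) → ℂ, ∫ t : ℝ, ‖1 - riemannZeta (1 / 2 + t * I) *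
        ∑ n : Fin (N ^ 2), a n * ((n : ℂ) + 1) ^ (-(1 / 2 + t * I))‖ ^ 2 / (1 / 4 + t ^ 2) := by
  obtain ⟨c, hc, hfloor⟩ := nb_dist_floor_pos_of_not_rh hRH
  exact antiDoubling_of_antitone_of_floor (fun N ↦ ⨅ a : Fin N → ℂ, ∫ t : ℝ,
      ‖1 - riemannZeta (1 / 2 + t * I) * ∑ n : Fin N, a n * ((n : ℂ) + 1) ^ (-(1 / 2 + t * I))‖ ^ 2 /
        (1 / 4 + t ^ 2)) nb_dist_antitone hc hfloor hθ

/-- **Natural approximants: lower tails under ¬RH.** If RH fails, `I(V_N)` of the natural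
approximants `V_N = Σ_{n≤N} μ(n)(1 - log n/log N) n^{-s}` exceeds every bound `B` from some level on
(the tree's dichotomy `rh_or_tendsto_natural_atTop`: RH ∨ `I(V_N) → ∞`).  So «`I(V_N)` unbounded /
`→ ∞` / `> B` beyond `H`» are `¬RH`-implied conjuncts (idle), dual to the costume side
`rh_of_natural_tailBdd` (bounded natural tail ⟹ RH alone). [cite: BaezDuarte2003, Thm. 1.1] -/
theorem natural_lowerTail_of_not_rh (hRH : ¬ _root_.RiemannHypothesis) (B : ℝ) :
    ∃ H₀ : ℕ, ∀ N : ℕ, H₀ ≤ N → ENNReal.ofReal B <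
      ∫⁻ t : ℝ, ENNReal.ofReal (‖1 - riemannZeta (1 / 2 + t * Complex.I) *
        ∑ n : Fin N, ((ArithmeticFunction.moebius (n + 1) : ℝ) *
          (1 - Real.log ((n : ℝ) + 1) / Real.log N) : ℂ) * ((n : ℂ) + 1) ^ (-(1 / 2 + t * Complex.I))‖ ^ 2 /
            (1 / 4 + t ^ 2)) := by
  rcases rh_or_tendsto_natural_atTop with h | h
  · exact absurd h hRH
  · exact eventually_atTop.1 (h.eventually (lt_mem_nhds ENNReal.ofReal_lt_top))

/-! ## §TP.2 — VISIBILITY LEVEL of an off-line zero under a rate conjunct (detector VII, NB rows) -/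

/-- The sharp floor constant `F(ρ) = 4π(Re ρ-1/2)‖ρ-1‖²/(‖ρ‖²‖ρ+1‖²)` is positive at an off-line
zero (`ρ ≠ 1` by `riemannZeta_one_ne_zero`; `ρ ≠ 0, -1` by `Re ρ > 1/2`). [folklore] -/
theorem sharpFloor_pos {ρ : ℂ} (hζ : riemannZeta ρ = 0) (hρ : 1 / 2 < ρ.re) :
    0 < 4 * π * (ρ.re - 1 / 2) * ‖ρ - 1‖ ^ 2 / (‖ρ‖ ^ 2 * ‖ρ + 1‖ ^ 2) := by
  have hρ1 : ρ ≠ 1 := fun h1 ↦ riemannZeta_one_ne_zero (h1 ▸ hζ)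
  have hρ0 : ρ ≠ 0 := by
    intro h0; rw [h0] at hρ; simp at hρ; linarith
  have hρm1 : ρ + 1 ≠ 0 := by
    intro h0
    have : (ρ + 1).re = 0 := by rw [h0]; simp
    simp at this; linarith
  have hn1 : 0 < ‖ρ - 1‖ := norm_pos_iff.mpr (sub_ne_zero.mpr hρ1)
  have hn0 : 0 < ‖ρ‖ := norm_pos_iff.mpr hρ0
  have hnm1 : 0 < ‖ρ + 1‖ := norm_pos_iff.mpr hρm1
  have hδ0 : 0 < ρ.re - 1 / 2 := by linarith
  positivity

/-- **VISIBILITY of an off-line zero (threshold form).** A zero `ρ` of `ζ` with `Re ρ > 1/2` refutes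
the rate conjunct «`∃ a, I(N,a) ≤ C/log N`» at EVERY level `N` with `C/log N < F(ρ)`,
`F(ρ) = 4π(Re ρ-1/2)‖ρ-1‖²/(‖ρ‖²‖ρ+1‖²)` (`≈ 4πδ/γ₀²` for `ρ = 1/2+δ+iγ₀`, `γ₀` large): for every `a`,
`C/log N < I(N,a)`.  Read with `nb_zero_free_region_of_witness_sharp` (a witness `I(N,a) < η` excludes
exactly the zeros with `F(ρ) ≥ η`... up to `‖·‖`-coordinates) this is the RESOLUTION LAW of the
Báez-Duarte distance: `log N_vis(ρ,C) = C/F(ρ) ≈ (C/4π)·γ₀²/δ`, `C/4π ∈ [0.0170, 0.0231]` for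
`C ∈ [0.214, 0.2902]`. [cite: Beurling1955, Theorem (easy half)] [cite: Nikolski1995, Thm 0.1] -/
theorem nb_rateLevel_refuted_by_zero {ρ : ℂ} (hζ : riemannZeta ρ = 0) (hρ : 1 / 2 < ρ.re)
    {C : ℝ} {N : ℕ}
    (hvis : C / Real.log N < 4 * π * (ρ.re - 1 / 2) * ‖ρ - 1‖ ^ 2 / (‖ρ‖ ^ 2 * ‖ρ + 1‖ ^ 2))
    (a : Fin N → ℂ) :
    ENNReal.ofReal (C / Real.log N) <
      ∫⁻ t : ℝ, ENNReal.ofReal (‖1 - riemannZeta (1 / 2 + t * Complex.I) *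
        ∑ n : Fin N, a n * ((n : ℂ) + 1) ^ (-(1 / 2 + t * Complex.I))‖ ^ 2 / (1 / 4 + t ^ 2)) :=
  ((ENNReal.ofReal_lt_ofReal_iff (sharpFloor_pos hζ hρ)).mpr hvis).trans_le
    (nbIntegrand_sharpFloor_of_zero hζ hρ N a)

/-- **VISIBILITY LEVEL, solved for `N`.** For `C > 0` and every level `N > exp(C/F(ρ))` — i.e.
`log N > C‖ρ‖²‖ρ+1‖²/(4π(Re ρ-1/2)‖ρ-1‖²)` — the off-line zero `ρ` refutes «`∃ a, I(N,a) ≤ C/log N`».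
Numbers (`C = 0.2902`, the printed constant `2π(2+γ-log 4π)`; first plant beyond the Platt–Trudgian
height, `γ₀ = 3·10¹²`, `δ = 0.1`): `log N_vis ≈ 0.0231·γ₀²/δ ≈ 2.1·10²⁴`; at `γ₀ = 14.13`, `δ = 0.1`:
`log N_vis ≈ 47` (`N_vis ≈ 10²⁰`).  [cite: Nikolski1995, Thm 0.1] [cite: BDBLS2000, conjecture] -/
theorem nb_rateLevel_refuted_by_zero_exp {ρ : ℂ} (hζ : riemannZeta ρ = 0) (hρ : 1 / 2 < ρ.re)
    {C : ℝ} (hC : 0 < C) {N : ℕ}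
    (hN : Real.exp (C / (4 * π * (ρ.re - 1 / 2) * ‖ρ - 1‖ ^ 2 / (‖ρ‖ ^ 2 * ‖ρ + 1‖ ^ 2))) < N)
    (a : Fin N → ℂ) :
    ENNReal.ofReal (C / Real.log N) <
      ∫⁻ t : ℝ, ENNReal.ofReal (‖1 - riemannZeta (1 / 2 + t * Complex.I) *
        ∑ n : Fin N, a n * ((n : ℂ) + 1) ^ (-(1 / 2 + t * Complex.I))‖ ^ 2 / (1 / 4 + t ^ 2)) := by
  refine nb_rateLevel_refuted_by_zero hζ hρ ?_ a
  have hF := sharpFloor_pos hζ hρ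
  have h1 : C / (4 * π * (ρ.re - 1 / 2) * ‖ρ - 1‖ ^ 2 / (‖ρ‖ ^ 2 * ‖ρ + 1‖ ^ 2)) < Real.log N := by
    have := Real.log_lt_log (Real.exp_pos _) hN
    rwa [Real.log_exp] at this
  have hlogpos : 0 < Real.log N := (div_pos hC hF).trans h1
  rw [div_lt_iff₀ hlogpos]
  rw [div_lt_iff₀ hF] at h1
  linarith

/-- **The rate TAIL is refuted at every `H` by any off-line zero** (pointwise-in-`ρ`, effective form
of `rh_of_nb_rateTail`: the level is `N = max(H, N_vis(ρ, C))`).  So in a splitting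
`FIN(H) ∧ RateTail(C,H) ⟹ RH` the tail does ALL the work at the single level `N_vis` where the
hypothetical zero becomes visible, and none below it. [cite: Nikolski1995, Thm 0.1] -/
theorem not_nb_rateTail_of_zero {ρ : ℂ} (hζ : riemannZeta ρ = 0) (hρ : 1 / 2 < ρ.re)
    (C : ℝ) (H : ℕ) :
    ¬ ∀ N : ℕ, H ≤ N → ∃ a : Fin N → ℂ,
      ∫⁻ t : ℝ, ENNReal.ofReal (‖1 - riemannZeta (1 / 2 + t * Complex.I) *
        ∑ n : Fin N, a n * ((n : ℂ) + 1) ^ (-(1 / 2 + t * Complex.I))‖ ^ 2 / (1 / 4 + t ^ 2)) ≤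
      ENNReal.ofReal (C / Real.log N) := by
  intro h
  have hF := sharpFloor_pos hζ hρ
  have ht : Tendsto (fun N : ℕ ↦ C / Real.log N) atTop (𝓝 0) :=
    tendsto_const_nhds.div_atTop (Real.tendsto_log_atTop.comp tendsto_natCast_atTop_atTop)
  obtain ⟨N, hNlt, hNH⟩ := ((ht.eventually (gt_mem_nhds hF)).and (eventually_ge_atTop H)).exists
  obtain ⟨a, ha⟩ := h N hNH
  exact absurd (ha.trans_lt (nb_rateLevel_refuted_by_zero hζ hρ hNlt a)) (lt_irrefl _)

/-- **Witness ⟹ level bound (the converse reading).** A witness `I(N,a) < C/log N` at a level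
`N ≥ 2` forces `N < exp(C/F(ρ))` for EVERY off-line zero `ρ` — below `N_vis(ρ,C)` the zero is
INVISIBLE to a `C/log N`-certificate, above it no such certificate exists.  (Restates the tree's
`nb_zero_constraint_of_witness_sharp` on the level axis.) [cite: Nikolski1995, Thm 0.1] -/
theorem nb_witnessLevel_lt_exp {N : ℕ} (hN : 2 ≤ N) {a : Fin N → ℂ} {C : ℝ}
    (h : ∫⁻ t : ℝ, ENNReal.ofReal (‖1 - riemannZeta (1 / 2 + t * Complex.I) *
        ∑ n : Fin N, a n * ((n : ℂ) + 1) ^ (-(1 / 2 + t * Complex.I))‖ ^ 2 / (1 / 4 + t ^ 2)) <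
      ENNReal.ofReal (C / Real.log N))
    {ρ : ℂ} (hζ : riemannZeta ρ = 0) (hρ : 1 / 2 < ρ.re) :
    (N : ℝ) < Real.exp (C / (4 * π * (ρ.re - 1 / 2) * ‖ρ - 1‖ ^ 2 / (‖ρ‖ ^ 2 * ‖ρ + 1‖ ^ 2))) := by
  have hc := nb_zero_constraint_of_witness_sharp h hζ hρ
  have hF := sharpFloor_pos hζ hρ
  have hN1 : (1 : ℝ) < N := by exact_mod_cast hN
  have hlog : 0 < Real.log N := Real.log_pos hN1
  have h1 : Real.log N < C / (4 * π * (ρ.re - 1 / 2) * ‖ρ - 1‖ ^ 2 / (‖ρ‖ ^ 2 * ‖ρ + 1‖ ^ 2)) := by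
    rw [lt_div_iff₀ hF]
    rw [lt_div_iff₀ hlog] at hc
    linarith
  calc (N : ℝ) = Real.exp (Real.log N) := (Real.exp_log (by linarith)).symm
    _ < _ := Real.exp_lt_exp.mpr h1

end Summit.RiemannHypothesis.RiemannHypothesis.Theorems.Splittings.NbTailPolarisation

end
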